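import Mathlib
import HarnessLib

/-!
# Decay of the light-cone profile: receptive depth versus accuracy

HONEST FRAMING. This venture is about exact (Metropolis-corrected) sampling algorithms for lattice
gauge theory; figures of merit are autocorrelation/cost numbers at stated couplings and volumes; no
continuum-physics claim. This file is elementary real analysis.

THEOREM L (`FlowLightCone.lean`) bounds the influence of input links at read-depth `m` on an output
link of a flow-defined map by the profile `δ e^{Kt}(Kt)^m/m!`. This file turns the profile into the
NETWORK-SIZE statement used in THEORY-1 §26.10: since `s^m/m! ≤ e^{−m}` as soon as `m ≥ e²s`
(`pow_div_factorial_le_exp_neg`, from `m^m/m! ≤ e^m`), the profile is `≤ δ e^{Kt − m}`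
(`coneProfile_le_exp_sub`), hence `≤ ε` for every receptive depth
`m ≥ max(e²·Kt, Kt + log(δ/ε))` (`coneProfile_le_of_depth`). With THEOREM L's `δ = 2n` and
`K = nK_Z + M_Z` independent of the lattice size, the receptive depth needed for accuracy `ε` is
`O(KT + log(n/ε))` read-hops — independent of the volume, linear in `KT`, logarithmic in `1/ε`.
Everything is [ours]/[folklore]; no source beyond `Real.pow_div_factorial_le_exp` (Mathlib).
-/

open Real
open scoped Nat

namespace Summit.Ventures.LatticeQCDFlow.TrivializingMaps.LightCone

/-- `s^m/m! ≤ e^{−m}` whenever `m ≥ e²·s` (`s ≥ 0`): from `m^m/m! ≤ e^m`, `s^m/m! ≤ (es/m)^m ≤ e^{−m}`.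
[folklore] -/
theorem pow_div_factorial_le_exp_neg {s : ℝ} (hs : 0 ≤ s) {m : ℕ} (hm : exp 2 * s ≤ m) :
    s ^ m / (m ! : ℝ) ≤ exp (-(m : ℝ)) := by
  rcases Nat.eq_zero_or_pos m with rfl | hmpos
  · simp
  · have hm' : (0 : ℝ) < m := by exact_mod_cast hmpos
    have hfac : (m : ℝ) ^ m / (m ! : ℝ) ≤ exp m := pow_div_factorial_le_exp (m : ℝ) (Nat.cast_nonneg m) m
    have hkey : s ^ m / (m ! : ℝ) = (s / m) ^ m * ((m : ℝ) ^ m / (m ! : ℝ)) := by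
      rw [div_pow]
      have hfne : (m ! : ℝ) ≠ 0 := by positivity
      have hmne : (m : ℝ) ^ m ≠ 0 := pow_ne_zero _ hm'.ne'
      field_simp
    have hratio : s / m * exp 1 ≤ exp (-1) := by
      rw [div_mul_eq_mul_div, div_le_iff₀ hm']
      have h12 : exp (-1) * exp 2 = exp 1 := by rw [← exp_add]; norm_num
      calc s * exp 1 = exp (-1) * (exp 2 * s) := by rw [← h12]; ring
        _ ≤ exp (-1) * m := mul_le_mul_of_nonneg_left hm (exp_pos _).le
    rw [hkey]
    calc (s / m) ^ m * ((m : ℝ) ^ m / (m ! : ℝ))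
        ≤ (s / m) ^ m * exp m :=
          mul_le_mul_of_nonneg_left hfac (pow_nonneg (div_nonneg hs hm'.le) _)
      _ = (s / m * exp 1) ^ m := by rw [mul_pow, ← exp_nat_mul, mul_one]
      _ ≤ (exp (-1)) ^ m := pow_le_pow_left₀ (by positivity) hratio m
      _ = exp (-(m : ℝ)) := by rw [← exp_nat_mul, mul_neg, mul_one]

/-- **The profile beyond depth `e²Kt` decays exponentially in the depth**:
`δ e^{Kt}(Kt)^m/m! ≤ δ e^{Kt − m}` for `m ≥ e²·Kt`. [ours] -/
theorem coneProfile_le_exp_sub {δ K t : ℝ} (hδ : 0 ≤ δ) (hKt : 0 ≤ K * t) {m : ℕ}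
    (hm : exp 2 * (K * t) ≤ m) :
    δ * exp (K * t) * (K * t) ^ m / (m ! : ℝ) ≤ δ * exp (K * t - m) := by
  have h := pow_div_factorial_le_exp_neg hKt hm
  calc δ * exp (K * t) * (K * t) ^ m / (m ! : ℝ)
      = δ * exp (K * t) * ((K * t) ^ m / (m ! : ℝ)) := by ring
    _ ≤ δ * exp (K * t) * exp (-(m : ℝ)) := mul_le_mul_of_nonneg_left h (by positivity)
    _ = δ * exp (K * t - m) := by rw [sub_eq_add_neg, exp_add]; ring

/-- **RECEPTIVE DEPTH VERSUS ACCURACY.** If the depth `m` satisfies `m ≥ e²·Kt` and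
`m ≥ Kt + log(δ/ε)`, then `δ e^{Kt}(Kt)^m/m! ≤ ε`. With THEOREM L (`δ = 2n`, `K = nK_Z + M_Z`
volume-independent): an output link of the flow map is reproduced to accuracy `ε` (Frobenius norm) by
the input links within `max(e²KT, KT + log(2n/ε))` read-hops, AT EVERY VOLUME. [ours] -/
theorem coneProfile_le_of_depth {δ K t ε : ℝ} (hδ : 0 ≤ δ) (hKt : 0 ≤ K * t) (hε : 0 < ε) {m : ℕ}
    (hm1 : exp 2 * (K * t) ≤ m) (hm2 : K * t + log (δ / ε) ≤ m) :
    δ * exp (K * t) * (K * t) ^ m / (m ! : ℝ) ≤ ε := by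
  refine (coneProfile_le_exp_sub hδ hKt hm1).trans ?_
  rcases hδ.eq_or_lt with h0 | hδpos
  · rw [← h0, zero_mul]; exact hε.le
  · have hquot : 0 < δ / ε := div_pos hδpos hε
    have hexp : exp (K * t - m) ≤ ε / δ := by
      have h1 : K * t - m ≤ -log (δ / ε) := by linarith
      calc exp (K * t - m) ≤ exp (-log (δ / ε)) := exp_le_exp.2 h1
        _ = ε / δ := by rw [exp_neg, exp_log hquot, inv_div]
    calc δ * exp (K * t - m) ≤ δ * (ε / δ) := mul_le_mul_of_nonneg_left hexp hδ
      _ = ε := mul_div_cancel₀ ε hδpos.ne'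

/-- The depth condition in ONE ceiling: `m := ⌈max(e²Kt, Kt + log(δ/ε))⌉₊` works. [ours] -/
theorem coneProfile_le_at_ceil_depth {δ K t ε : ℝ} (hδ : 0 ≤ δ) (hKt : 0 ≤ K * t) (hε : 0 < ε) :
    δ * exp (K * t) * (K * t) ^ ⌈max (exp 2 * (K * t)) (K * t + log (δ / ε))⌉₊
        / ((⌈max (exp 2 * (K * t)) (K * t + log (δ / ε))⌉₊)! : ℝ) ≤ ε :=
  coneProfile_le_of_depth hδ hKt hε
    ((le_max_left _ _).trans (Nat.le_ceil _))
    ((le_max_right _ _).trans (Nat.le_ceil _))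

end Summit.Ventures.LatticeQCDFlow.TrivializingMaps.LightCone
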